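import Summits.HodgeConjecture.HodgeConjecture.Theorems.HeckePrymWeilCmLadderWitness
import Literature.AlgebraicGeometry.HodgeTheory.WeilSurfaceCMSquareAlgebraic
import Literature.AlgebraicGeometry.HodgeTheory.WeilClassesDescendingProofs
import Literature.AlgebraicGeometry.HodgeTheory.WeilClassesIsogenyDescent
import Literature.AlgebraicGeometry.Motives.AimedSplitProductDischarge
import Literature.AlgebraicGeometry.Motives.AbelianVarietyCohomologyExteriorH1
import Literature.NumberTheory.EllipticCurves.CMEndomorphismOfMulMemLattice
import HarnessLib

/-!
# Route `HeckePrymWeil`, CM-anchor ladder · the CM ANCHOR in every dimension (every `d ≥ 1`)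

Crux `WeilTwelvefoldsSqrtMinus7` (stmt-HodgeConjecture-1261), line `isotypic-unimodular-saturation`,
skeleton r2 (lead seat c3).  The anchor fibre of the black-box transport only has to be a HYPERBOLIC
`ℚ(√-d)`-Weil abelian variety WITH AN ALGEBRAIC WEIL PLANE; this file supplies one in every dimension
`2(n+1)`, `n ≥ 1`, for every `d ≥ 1` — the CM power `B^{n+1}`, `B = E₀ × E₀` the tree's CM square
(`E₀ = ℂ/(ℤ + ℤ√-d)`, `ψ = ([√-d], -[√-d])`; `exists_cmCurve_sqrt_neg`, `exists_weilType_cmSquare_partner`,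
`weilClassesPlus/Minus_cmSquare_le_algebraicClasses`, `Motives.aimedSplitProduct_cmSquare_of_pos`) —
in the tree's strong typing `weilClassesOf`:

* `surfaceProductStep_of_pos` — ONE PRODUCT STEP, every `d ≥ 1`: algebraic Weil planes of `(A, φ)`
  (dimension `2n`) and of a surface `(B, ψ)` give an algebraic Weil plane of `(A × B, φ × ψ)` (the
  sibling `stub_surfaceProductStep_of_exteriorH1`, whose unused primality hypotheses are dropped;
  unconditional by `abelianVarietyCohomologyExteriorH1_holds`);
* `exists_cmTower` — for every `k ≥ 1` a `ℚ(√-d)`-Weil `2k`-fold `(Z, φ_Z)` (`Z = B^k`) with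
  ALGEBRAIC Weil plane and a NON-ZERO rational `(k,k)` Weil class (induction with
  `weilWitness_prod`);
* `weilClassesOf_le_algebraicClasses_of_isogenyPair` — algebraic Weil planes pass along an isogeny
  pair `f : Y → X` (flat), `g : X → Y`, `f ≫ g = m·𝟙`, `g` intertwining (van Geemen 3.6–3.7);
* `exists_cmAnchor_hyperbolic` — for every `n ≥ 1` a HYPERBOLIC `ℚ(√-d)`-Weil `2(n+1)`-fold
  (`B^n × B` with the `K`-symmetrised hyperplane class of a Segre-type projective embedding) with
  ALGEBRAIC Weil plane.

No named fact, no `sorry`, no new definition.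
-/

noncomputable section

-- every declaration of this problem lives in Summit.HodgeConjecture.HodgeConjecture.… (summit = sub-problem)
set_option linter.dupNamespace false

open CategoryTheory
open Literature.AlgebraicGeometry Literature.AlgebraicGeometry.Motives
  Literature.AlgebraicGeometry.HodgeTheory Literature.AlgebraicTopology.SingularHomology

namespace Summit.HodgeConjecture.HodgeConjecture.Theorems.HeckePrymWeilLine

/-! ### One product step, every `d ≥ 1` -/

/-- **ONE PRODUCT STEP of the anchor, every `d ≥ 1`** (van Geemen, proof of Thm. 6.12; Schoen 1998
§10 "`W_{A×A'} ⊗ ℂ : ω_{1,σ} ∧ ⋯ ∧ ω_{6,σ}`"): if the Weil planes `weilClassesOf A φ n d` (`A` of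
dimension `2n`, `φ² = -d`) and `weilClassesOf B ψ 1 d` (`B` a surface, `ψ² = -d`) consist of
algebraic classes, so does `weilClassesOf (A × B) (φ × ψ) (n+1) d`.  Proof = the sibling
`stub_surfaceProductStep_of_exteriorH1` (each Weil line of `A`, `B`, `A × B` is a LINE by
`finrank_weilClassesPlus/Minus_eq_one`, the exterior product of non-zero algebraic generators is a
non-zero algebraic element of the product's line), with `H• = ⋀•H¹` supplied by
`abelianVarietyCohomologyExteriorH1_holds` and the unused primality hypotheses dropped.
[cite: vanGeemen1994HodgeAV, proof of Thm. 6.12] [cite: Schoen1998HodgeWeilAddendum, §10 (proof of the Proposition)] -/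
theorem surfaceProductStep_of_pos {d : ℕ} (hd : 0 < d) (n : ℕ) (A : AbelianVariety ℂ) (φ : A ⟶ A)
    (B : AbelianVariety ℂ) (ψ : B ⟶ B) (hA : A.dim = 2 * n) (hB : B.dim = 2)
    (hφ : φ ≫ φ = -(d • 𝟙 A)) (hψ : ψ ≫ ψ = -(d • 𝟙 B))
    (hAalg : weilClassesOf A φ n d ≤ algebraicClasses A.X n)
    (hBalg : weilClassesOf B ψ 1 d ≤ algebraicClasses B.X 1) :
    weilClassesOf (A.prod B)
        (AbelianVariety.prodLift (AbelianVariety.fst A B ≫ φ) (AbelianVariety.snd A B ≫ ψ)) (n + 1) d ≤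
      algebraicClasses (A.prod B).X (n + 1) := by
  have hΛ := abelianVarietyCohomologyExteriorH1_holds
  have hB1 : B.dim = 2 * 1 := hB
  set Φ := AbelianVariety.prodLift (AbelianVariety.fst A B ≫ φ) (AbelianVariety.snd A B ≫ ψ)
  have hΦ : Φ ≫ Φ = -(d • 𝟙 (A.prod B)) := prodLift_comp_self_eq_neg_nsmul hφ hψ
  have h₁ : Φ ≫ AbelianVariety.fst A B = AbelianVariety.fst A B ≫ φ :=
    AbelianVariety.prodLift_fst _ _
  have h₂ : Φ ≫ AbelianVariety.snd A B = AbelianVariety.snd A B ≫ ψ :=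
    AbelianVariety.prodLift_snd _ _
  have hAsp : IsSmoothProjective (2 * n) A.X := sps_isSmoothProjective_of_dim_eq A hA
  have hBsp : IsSmoothProjective (2 * 1) B.X := sps_isSmoothProjective_of_dim_eq B hB1
  -- `b₁ = 2 dim` for `A`, `B`, `A × B`
  have hbA : Module.finrank ℂ (complexBetti A.X 1) = 2 * (2 * n) := by rw [(hΛ A).2.1, hA]
  have hbB : Module.finrank ℂ (complexBetti B.X 1) = 2 * (2 * 1) := by rw [(hΛ B).2.1, hB1]
  have hbC : Module.finrank ℂ (complexBetti (A.prod B).X 1) = 2 * (2 * (n + 1)) := by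
    rw [(hΛ (A.prod B)).2.1, AbelianVariety.dim_prod, hA, hB1]; ring
  -- the two lines of the product
  rw [weilClassesOf]
  refine sup_le ?_ ?_
  · obtain ⟨a₀, ha₀, ha0⟩ := sps_exists_ne_zero_of_finrank_eq_one
      (finrank_weilClassesPlus_eq_one (hΛ A).2.2 hbA hd hφ)
    obtain ⟨b₀, hb₀, hb0⟩ := sps_exists_ne_zero_of_finrank_eq_one
      (finrank_weilClassesPlus_eq_one (hΛ B).2.2 hbB hd hψ)
    exact sps_line_le_algebraicClasses hAsp hBsp
      (fun c hc hc0 ↦ weilClassesPlus_le_span_singleton (hΛ (A.prod B)).2.2 hbC hd hΦ hc hc0)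
      (hAalg (weilClassesPlus_le_weilClassesOf A φ n d ha₀))
      (hBalg (weilClassesPlus_le_weilClassesOf B ψ 1 d hb₀)) ha0 hb0
      (cupProduct_map_fst_map_snd_mem_weilClassesPlus h₁ h₂ ha₀ hb₀)
  · obtain ⟨a₀, ha₀, ha0⟩ := sps_exists_ne_zero_of_finrank_eq_one
      (finrank_weilClassesMinus_eq_one (hΛ A).2.2 hbA hd hφ)
    obtain ⟨b₀, hb₀, hb0⟩ := sps_exists_ne_zero_of_finrank_eq_one
      (finrank_weilClassesMinus_eq_one (hΛ B).2.2 hbB hd hψ)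
    exact sps_line_le_algebraicClasses hAsp hBsp
      (fun c hc hc0 ↦ weilClassesMinus_le_span_singleton (hΛ (A.prod B)).2.2 hbC hd hΦ hc hc0)
      (hAalg (weilClassesMinus_le_weilClassesOf A φ n d ha₀))
      (hBalg (weilClassesMinus_le_weilClassesOf B ψ 1 d hb₀)) ha0 hb0
      (cupProduct_map_fst_map_snd_mem_weilClassesMinus h₁ h₂ ha₀ hb₀)

/-! ### The CM square `B = E₀ × E₀` and the CM tower `B^k` -/

/-- **The CM Weil surface, packaged for the tower** (every `d ≥ 1`): there are a complex abelian
SURFACE `B` and `ψ : B ⟶ B` with `ψ ≫ ψ = -d` whose Weil plane `weilClassesOf B ψ 1 d` is ALGEBRAIC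
and which carries Weil components `u₊ ∈ E₊`, `u₋ ∈ E₋`, BOTH non-zero, with `u₊ + u₋` rational of
Hodge type `(1,1)` — the CM square `E₀ × E₀`, `E₀ = ℂ/(ℤ + ℤ√-d)`, `ψ = ([√-d], -[√-d])` of the
tree (`exists_cmCurve_sqrt_neg`, `exists_weilType_cmSquare_partner`; the Weil lines are spanned by
classes of graphs of endomorphisms, `weilClassesPlus/Minus_cmSquare_le_algebraicClasses`).
[cite: Schoen1998HodgeWeilAddendum, §10 (proof of the Proposition, p. 333)]
[cite: vanGeemen1994HodgeAV, Lemma 5.2 and 5.3] -/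
theorem exists_cmSquare_weilPlane_algebraic {d : ℕ} (hd : 0 < d) :
    ∃ (B : AbelianVariety ℂ) (ψ : B ⟶ B), B.dim = 2 ∧ ψ ≫ ψ = -(d • 𝟙 B) ∧
      weilClassesOf B ψ 1 d ≤ algebraicClasses B.X 1 ∧
      ∃ up um : complexBetti B.X (2 * 1), up ∈ weilClassesPlus B ψ 1 d ∧
        um ∈ weilClassesMinus B ψ 1 d ∧ IsRationalClass (up + um) ∧
        IsOfHodgeType (2 * 1) B.X (2 * 1) 1 1 (up + um) ∧ up ≠ 0 ∧ um ≠ 0 := by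
  obtain ⟨E₀, ψ₀, hE, hψ⟩ :=
    Literature.NumberTheory.EllipticCurves.CMEndomorphism.exists_cmCurve_sqrt_neg d hd
  obtain ⟨h1, -, h3, up, um, hup, hum, hrat, htyp, hup0, hum0, -⟩ :=
    exists_weilType_cmSquare_partner hE hd hψ
  refine ⟨E₀.prod E₀, _, h1, h3, ?_, up, um, hup, hum, hrat, htyp, hup0, hum0⟩
  rw [weilClassesOf]
  exact sup_le (fun c hc ↦ weilClassesPlus_cmSquare_le_algebraicClasses hE hd hψ hc)
    (fun c hc ↦ weilClassesMinus_cmSquare_le_algebraicClasses hE hd hψ hc)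

/-- **The CM tower `B^k`** (every `d ≥ 1`, every `k ≥ 1`): a complex abelian `2k`-fold `(Z, φ_Z)`
with `φ_Z ≫ φ_Z = -d` whose Weil plane `weilClassesOf Z φ_Z k d` is ALGEBRAIC and which carries a
NON-ZERO rational `(k,k)` Weil class — `Z = B^k` for the CM square `B` of
`exists_cmSquare_weilPlane_algebraic`, by induction: `surfaceProductStep_of_pos` for the plane (van
Geemen, proof of Thm. 6.12) and `weilWitness_prod` for the class (Schoen's rational Weil projector).
In particular the Hodge conjecture holds for the Weil classes of these CM abelian varieties (their
Hodge rings are generated by divisors). [cite: vanGeemen1994HodgeAV, proof of Thm. 6.12]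
[cite: Schoen1998HodgeWeilAddendum, §10 (proof of the Proposition)] -/
theorem exists_cmTower {d : ℕ} (hd : 0 < d) :
    ∀ k : ℕ, 1 ≤ k → ∃ (Z : AbelianVariety ℂ) (φZ : Z ⟶ Z), Z.dim = 2 * k ∧
      φZ ≫ φZ = -(d • 𝟙 Z) ∧ weilClassesOf Z φZ k d ≤ algebraicClasses Z.X k ∧
      ∃ c : complexBetti Z.X (2 * k), IsRationalClass c ∧
        IsOfHodgeType (2 * k) Z.X (2 * k) k k c ∧ c ∈ weilClassesOf Z φZ k d ∧ c ≠ 0 := by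
  obtain ⟨B, ψ, hB, hψ, hBalg, up, um, hup, hum, hrat, htyp, hup0, hum0⟩ :=
    exists_cmSquare_weilPlane_algebraic hd
  have hB1 : B.dim = 2 * 1 := hB
  intro k hk
  induction k, hk using Nat.le_induction with
  | base =>
    refine ⟨B, ψ, hB1, hψ, hBalg, up + um, hrat, htyp,
      Submodule.add_mem _ (weilClassesPlus_le_weilClassesOf B ψ 1 d hup)
        (weilClassesMinus_le_weilClassesOf B ψ 1 d hum), ?_⟩
    -- `u₊ + u₋ ≠ 0`: else `u₋ = -u₊` lies in `E₊ ∩ E₋`, which a test operator `(x·𝟙 + ψ)^*`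
    -- separating the two characters in degree 2 shows to be `0`
    intro h0
    obtain ⟨x, hx₁₂, -⟩ := exists_nat_pow_ne_and
      (mul_ne_zero Complex.I_ne_zero (show (Real.sqrt d : ℂ) ≠ 0 by
        rw [Ne, Complex.ofReal_eq_zero]; exact (Real.sqrt_pos.mpr (by exact_mod_cast hd)).ne'))
      (m := 2 * 1) (m' := 2 * 1) (by norm_num) (by norm_num)
    have e₁ := (mem_weilClassesPlus_iff.mp hup) x 1
    have e₂ := (mem_weilClassesMinus_iff.mp hum) x 1
    simp only [Nat.cast_one, one_mul] at e₁ e₂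
    have hum' : um = -up := (neg_eq_of_add_eq_zero_right h0).symm
    rw [hum', map_neg, smul_neg, neg_inj] at e₂
    -- `e₂ : (x𝟙+ψ)^* up = (x - i√d)² • up`, `e₁ : (x𝟙+ψ)^* up = (x + i√d)² • up`
    have : (((x : ℂ) + Complex.I * (Real.sqrt d : ℂ)) ^ (2 * 1) -
        ((x : ℂ) - Complex.I * (Real.sqrt d : ℂ)) ^ (2 * 1)) • up = 0 := by
      rw [sub_smul, ← e₁, ← e₂, sub_self]
    rcases smul_eq_zero.mp this with h | h
    · exact hx₁₂ (sub_eq_zero.mp h)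
    · exact hup0 h
  | succ k hk ih =>
    obtain ⟨Z, φZ, hZ, hφZ, hZW, hwit⟩ := ih
    refine ⟨Z.prod B, AbelianVariety.prodLift (AbelianVariety.fst Z B ≫ φZ) (AbelianVariety.snd Z B ≫ ψ),
      ?_, prodLift_comp_self_eq_neg_nsmul hφZ hψ, surfaceProductStep_of_pos hd k Z φZ B ψ hZ hB hφZ hψ hZW hBalg,
      ?_⟩
    · rw [AbelianVariety.dim_prod, hZ, hB]; ring
    · exact weilWitness_prod (n₁ := k) (n₂ := 1) (by omega) (by norm_num) hd (by ring) hZ hB1 hup hum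
        hrat htyp hup0 hum0 hwit

/-! ### Algebraic Weil planes along isogeny pairs -/

/-- **Algebraic Weil planes pass along an isogeny pair** (van Geemen LNM 1594, 3.6–3.7; Markman
§11.5 Step 1): let `(X, Φ)` have an algebraic Weil plane `weilClassesOf X Φ n d`, and let
`f : Y → X` be FLAT, `g : X → Y` with `f ≫ g = m·𝟙_Y` (`m ≥ 1`) and `g ≫ ψ = Φ ≫ g`.  Then
`weilClassesOf Y ψ n d` is algebraic: `g^* c` is a Weil class of `X` (`map_mem_weilClassesOf_of_comm`),
hence algebraic, so is its flat pull-back `f^* g^* c = (m·𝟙)^* c = m^{2n} · c`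
(`map_mem_algebraicClasses_of_flat`, `map_nsmul_id_eq_of_mem_weilClassesOf`), and `m^{2n} ≠ 0`.
[cite: vanGeemen1994HodgeAV, 3.6–3.7] [cite: Markman2025SurveySecant, §11.5 Step 1] -/
theorem weilClassesOf_le_algebraicClasses_of_isogenyPair {X Y : AbelianVariety ℂ} {Φ : X ⟶ X}
    {ψ : Y ⟶ Y} {n d : ℕ} (hXalg : weilClassesOf X Φ n d ≤ algebraicClasses X.X n)
    (f : Y ⟶ X) (g : X ⟶ Y) (m : ℕ) (hflat : AlgebraicGeometry.Flat f.hom.hom.hom.left) (hm : 0 < m)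
    (hfg : f ≫ g = m • 𝟙 Y) (hgψ : g ≫ ψ = Φ ≫ g) :
    weilClassesOf Y ψ n d ≤ algebraicClasses Y.X n := by
  intro c hcW
  have hgc : singularCohomology.map ℂ ℂ (AlgPoints.mapContinuous (L := ℂ) g.hom.hom.hom) (2 * n) c ∈
      algebraicClasses X.X n :=
    hXalg (map_mem_weilClassesOf_of_comm (n := n) (d := d) hgψ hcW)
  haveI : AlgebraicGeometry.IsLocallyNoetherian Y.X.left :=
    IsSmoothProjective.isLocallyNoetherian_holds (AbelianVariety.isSmoothProjective_holds (A := Y))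
  haveI : AlgebraicGeometry.IsLocallyNoetherian X.X.left :=
    IsSmoothProjective.isLocallyNoetherian_holds (AbelianVariety.isSmoothProjective_holds (A := X))
  haveI : AlgebraicGeometry.Flat f.hom.hom.hom.left := hflat
  have hfgc := map_mem_algebraicClasses_of_flat f.hom.hom.hom hgc
  have key : complexBetti.map f.hom.hom.hom (2 * n)
      (singularCohomology.map ℂ ℂ (AlgPoints.mapContinuous (L := ℂ) g.hom.hom.hom) (2 * n) c) =
        ((m : ℂ) ^ (2 * n)) • c := by
    change singularCohomology.map ℂ ℂ (AlgPoints.mapContinuous (L := ℂ) f.hom.hom.hom) (2 * n)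
      (singularCohomology.map ℂ ℂ (AlgPoints.mapContinuous (L := ℂ) g.hom.hom.hom) (2 * n) c) = _
    rw [abelianVarietyHom_map_map_apply, hfg, map_nsmul_id_eq_of_mem_weilClassesOf m hcW]
  rw [key] at hfgc
  have hmC : ((m : ℂ) ^ (2 * n)) ≠ 0 := pow_ne_zero _ (Nat.cast_ne_zero.mpr hm.ne')
  have h := Submodule.smul_mem (algebraicClasses Y.X n) (((m : ℂ) ^ (2 * n))⁻¹) hfgc
  rwa [smul_smul, inv_mul_cancel₀ hmC, one_smul] at h

/-! ### The hyperbolic CM anchor in every dimension -/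

/-- **A HYPERBOLIC `ℚ(√-d)`-Weil abelian variety with ALGEBRAIC Weil plane in every dimension
`2(n+1)`, `n ≥ 1`, every `d ≥ 1`**: `X = B^n × B` for the CM square `B = E₀ × E₀`
(`ψ = ([√-d], -[√-d])`), hyperbolic (= split: a `Φ^*`-stable rational Lagrangian frame) for the
`K`-symmetrised hyperplane class `d·e^*a + Φ^*e^*a` of a projective embedding `e` with `a` rational
non-zero (Markman's product trick `Motives.aimedSplitProduct_cmSquare_of_pos`, fed with the non-zero
rational `(n,n)` Weil class of `B^n` from `exists_cmTower`), and with algebraic Weil plane (the tower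
step once more).  This is the anchor fibre of the CM-anchor ladder: on it EVERY Weil class is
algebraic, so any flat Weil section reaching it is algebraic there.
[cite: Markman2025SurveySecant, §11.5 Step 1–2] [cite: vanGeemen1994HodgeAV, Lemma 5.2, 5.3–5.4 and proof of Thm. 6.12] -/
theorem exists_cmAnchor_hyperbolic {d : ℕ} (hd : 0 < d) {n : ℕ} (hn : 0 < n) :
    ∃ (X : AbelianVariety ℂ) (Φ : X ⟶ X) (e : ProjectiveEmbedding X.X)
      (a : complexBetti (projectiveSpace e.n ℂ) 2),
      X.dim = 2 * (n + 1) ∧ Φ ≫ Φ = -(d • 𝟙 X) ∧ IsRationalClass a ∧ a ≠ 0 ∧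
      IsHyperbolicWeilType X Φ (n + 1)
        ((d : ℂ) • complexBetti.map e.ι 2 a + complexBetti.map Φ.hom.hom.hom 2 (complexBetti.map e.ι 2 a)) ∧
      weilClassesOf X Φ (n + 1) d ≤ algebraicClasses X.X (n + 1) := by
  obtain ⟨E₀, ψ₀, hE, hψ₀⟩ :=
    Literature.NumberTheory.EllipticCurves.CMEndomorphism.exists_cmCurve_sqrt_neg d hd
  obtain ⟨hB1, -, hψ, -⟩ := exists_weilType_cmSquare_partner hE hd hψ₀
  have hB : (E₀.prod E₀).dim = 2 := hB1
  have hBalg : weilClassesOf (E₀.prod E₀)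
      (AbelianVariety.prodLift (AbelianVariety.fst E₀ E₀ ≫ ψ₀) (AbelianVariety.snd E₀ E₀ ≫ (-ψ₀))) 1 d ≤
        algebraicClasses (E₀.prod E₀).X 1 := by
    rw [weilClassesOf]
    exact sup_le (fun c hc ↦ weilClassesPlus_cmSquare_le_algebraicClasses hE hd hψ₀ hc)
      (fun c hc ↦ weilClassesMinus_cmSquare_le_algebraicClasses hE hd hψ₀ hc)
  obtain ⟨Z, φZ, hZ, hφZ, hZW, hwit⟩ := exists_cmTower hd n hn
  obtain ⟨e, a, ha, ha0, hhyp⟩ := aimedSplitProduct_cmSquare_of_pos hd hE hψ₀ hn hZ hφZ hwit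
  refine ⟨Z.prod (E₀.prod E₀), _, e, a, ?_, prodLift_comp_self_eq_neg_nsmul hφZ hψ, ha, ha0, hhyp, ?_⟩
  · rw [AbelianVariety.dim_prod, hZ, hB]; ring
  · exact surfaceProductStep_of_pos hd n Z φZ (E₀.prod E₀) _ hZ hB hφZ hψ hZW hBalg

end Summit.HodgeConjecture.HodgeConjecture.Theorems.HeckePrymWeilLine

end
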